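import Literature.MeasureTheory.Group.InvariantQuotientProd
import Literature.MeasureTheory.Group.InvariantQuotientNormalized
import HarnessLib

/-!
# The quotient measure of a product is the product of the quotient measures:
# `(ν₁ ⊗ ν₂)/(ρ₁ ⊗ ρ₂) = (ν₁/ρ₁) ⊗ (ν₂/ρ₂)` on `(G₁ × G₂) ⧸ (H₁ × H₂) = (G₁ ⧸ H₁) × (G₂ ⧸ H₂)`
(Folland, *A Course in Abstract Harmonic Analysis* (1995), §2.6, Thm. 2.49 / (2.52); Bump (1997),
Prop. 3.3.2: product Haar measures; the normalisation behind Gelbart's (10.19))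

Topic `MeasureTheory/Group`; namespace `Literature.MeasureTheory.Group`; theorems only (no
definition, no named fact, no instance visible to importers). `InvariantQuotientProd` shows that an
invariant measure on `(G₁ × G₂) ⧸ (H₁ × H₂)` is `c • (μ₁ ⊠ μ₂)` for SOME `c ≠ 0`; here the constant is
pinned down for the canonical quotient measures `quotientMeasure H ρ ν = ν/ρ` of
`InvariantQuotientExistence` / `InvariantQuotientNormalized` (Weil's formula with constant `1`):
if the Haar measures are products — `ν = ν₁ ⊗ ν₂` on `G₁ × G₂` and `ρ ↔ ρ₁ ⊗ ρ₂` on `H₁ × H₂` — then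
`c = 1`:

* `fiberLIntegral_prod_mul_eq` — fibre integrals of `f₁ ⊗ f₂` along `H₁ × H₂` factor:
  `(f₁ ⊗ f₂)^{H₁ × H₂}((a, b)(H₁ × H₂)) = f₁^{H₁}(a H₁) f₂^{H₂}(b H₂)`;
* `map_quotientProdHomeomorph_symm_prod_quotientMeasure_eq` /
  `map_quotientProdHomeomorph_quotientMeasure_prod` — **`(ν₁ ⊗ ν₂)/(ρ₁ ⊗ ρ₂) = (ν₁/ρ₁) ⊠ (ν₂/ρ₂)`**
  (the transported product is invariant and finite on compact sets, hence `c •` the quotient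
  measure with `c` its unfolding constant; Weil's formula for a product test function `g₁ ⊗ g₂` and
  Tonelli give `c ∫ g₁ ⊗ g₂ = (∫ g₁)(∫ g₂)`, so `c = 1`);
* `lintegral_quotientMeasure_prod_eq_lintegral_lintegral`, `integral_quotientMeasure_prod_eq_integral_prod`,
  `integral_quotientMeasure_prod_mul_eq_mul` — the resulting Fubini formulas WITHOUT constant, e.g.
  `∫_{(G₁×G₂)/(H₁×H₂)} f₁ ⊗ f₂ d((ν₁⊗ν₂)/(ρ₁⊗ρ₂)) = (∫_{G₁/H₁} f₁ d(ν₁/ρ₁))(∫_{G₂/H₂} f₂ d(ν₂/ρ₂))`.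

This is the measure-theoretic content of the equality sign in Gelbart's (10.19) (product of local
orbital integrals, for product Haar measures on `G_𝔸 = G_S × G^S` and on the tori
`B_𝔸 = B_S × B^S`). Part of the inline (D-0026) decomposition of
`Literature.NumberTheory.Automorphic.strong_multiplicity_one_quaternionUnits`.

## References

* G. B. Folland, *A Course in Abstract Harmonic Analysis* (1995), §2.6, Thm. 2.49, (2.52) [Folland1995].
* D. Bump, *Automorphic Forms and Representations* (1997), §3.3, Prop. 3.3.2 [Bump1997].
* S. Gelbart, *Automorphic forms on adele groups*, Ann. of Math. Studies 83 (1975), §10, p. 155,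
  (10.19) [Gelbart1975].
-/

noncomputable section

open MeasureTheory MeasureTheory.Measure Topology Filter
open scoped NNReal ENNReal

namespace Literature.MeasureTheory.Group

section Fiber

variable {G₁ G₂ : Type*} [Group G₁] [Group G₂] [TopologicalSpace G₁] [TopologicalSpace G₂]
  (H₁ : Subgroup G₁) (H₂ : Subgroup G₂)

/-- `H₁ × H₂` is closed in `G₁ × G₂` when `H₁`, `H₂` are. [folklore] -/
theorem isClosed_coe_prod (h₁ : IsClosed (H₁ : Set G₁)) (h₂ : IsClosed (H₂ : Set G₂)) :
    IsClosed ((H₁.prod H₂ : Subgroup (G₁ × G₂)) : Set (G₁ × G₂)) := by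
  rw [Subgroup.coe_prod]
  exact h₁.prod h₂

variable [IsTopologicalGroup G₁] [IsTopologicalGroup G₂] [SecondCountableTopology G₁] [SecondCountableTopology G₂]
  [MeasurableSpace G₁] [BorelSpace G₁] [MeasurableSpace G₂] [BorelSpace G₂]
  (ρ₁ : Measure H₁) [ρ₁.IsMulLeftInvariant] (ρ₂ : Measure H₂) [ρ₂.IsMulLeftInvariant] [SFinite ρ₂]
  (ρ : Measure (H₁.prod H₂)) [ρ.IsMulLeftInvariant]
  (hρ : Measure.map (Subgroup.prodEquiv H₁ H₂) ρ = ρ₁.prod ρ₂)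

include hρ in
/-- **Fibre integrals of product functions along `H₁ × H₂` factor**: for measurable
`f₁, f₂ ≥ 0` and `ρ ↔ ρ₁ ⊗ ρ₂`,
`∫_{H₁×H₂} f₁(a h₁) f₂(b h₂) dρ(h₁, h₂) = (∫_{H₁} f₁(a h₁) dρ₁)(∫_{H₂} f₂(b h₂) dρ₂)` (Tonelli).
[cite: Folland1995, §2.6 (2.52)] -/
theorem fiberLIntegral_prod_mul_eq {f₁ : G₁ → ℝ≥0∞} {f₂ : G₂ → ℝ≥0∞} (hf₁ : Measurable f₁) (hf₂ : Measurable f₂)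
    (a : G₁) (b : G₂) :
    fiberLIntegral (H₁.prod H₂) ρ (fun p : G₁ × G₂ => f₁ p.1 * f₂ p.2) (QuotientGroup.mk (a, b)) =
      fiberLIntegral H₁ ρ₁ f₁ (QuotientGroup.mk a) * fiberLIntegral H₂ ρ₂ f₂ (QuotientGroup.mk b) := by
  -- the homeomorphism `H₁ × H₂ ≃ₜ H₁ × H₂` (subgroup of the product vs product of subgroups)
  let e : (H₁.prod H₂) ≃ₜ H₁ × H₂ :=
    { toEquiv := (Subgroup.prodEquiv H₁ H₂).toEquiv
      continuous_toFun := ((continuous_fst.comp continuous_subtype_val).subtype_mk _).prodMk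
        ((continuous_snd.comp continuous_subtype_val).subtype_mk _)
      continuous_invFun := ((continuous_subtype_val.comp continuous_fst).prodMk
        (continuous_subtype_val.comp continuous_snd)).subtype_mk _ }
  have he : (e : (H₁.prod H₂) → H₁ × H₂) = Subgroup.prodEquiv H₁ H₂ := rfl
  have hρ' : Measure.map e.toMeasurableEquiv ρ = ρ₁.prod ρ₂ := by
    rw [Homeomorph.toMeasurableEquiv_coe, he, hρ]
  rw [fiberLIntegral_mk, fiberLIntegral_mk, fiberLIntegral_mk]
  have h1 : ∫⁻ h : (H₁.prod H₂), f₁ ((a, b) * (h : G₁ × G₂)).1 * f₂ ((a, b) * (h : G₁ × G₂)).2 ∂ρ =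
      ∫⁻ p : H₁ × H₂, f₁ (a * (p.1 : G₁)) * f₂ (b * (p.2 : G₂)) ∂(Measure.map e.toMeasurableEquiv ρ) := by
    rw [lintegral_map_equiv]
    rfl
  rw [h1, hρ']
  exact lintegral_prod_mul (μ := ρ₁) (ν := ρ₂) (f := fun h : H₁ => f₁ (a * (h : G₁))) (g := fun h : H₂ => f₂ (b * (h : G₂)))
    (hf₁.comp (measurable_const.mul measurable_subtype_coe)).aemeasurable
    (hf₂.comp (measurable_const.mul measurable_subtype_coe)).aemeasurable

end Fiber

section ProdNormalized

variable {G₁ G₂ : Type*} [Group G₁] [Group G₂] [TopologicalSpace G₁] [TopologicalSpace G₂]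
  [IsTopologicalGroup G₁] [IsTopologicalGroup G₂] [LocallyCompactSpace G₁] [LocallyCompactSpace G₂]
  [SecondCountableTopology G₁] [SecondCountableTopology G₂] [T2Space G₁] [T2Space G₂]
  [MeasurableSpace G₁] [BorelSpace G₁] [MeasurableSpace G₂] [BorelSpace G₂]
  (H₁ : Subgroup G₁) (H₂ : Subgroup G₂) [hH₁ : IsClosed (H₁ : Set G₁)] [hH₂ : IsClosed (H₂ : Set G₂)]
  (ρ₁ : Measure H₁) [ρ₁.IsMulLeftInvariant] [IsFiniteMeasureOnCompacts ρ₁] [ρ₁.IsOpenPosMeasure]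
  [ρ₁.IsInvInvariant] [SFinite ρ₁]
  (ρ₂ : Measure H₂) [ρ₂.IsMulLeftInvariant] [IsFiniteMeasureOnCompacts ρ₂] [ρ₂.IsOpenPosMeasure]
  [ρ₂.IsInvInvariant] [SFinite ρ₂]
  (ρ : Measure (H₁.prod H₂)) [ρ.IsMulLeftInvariant] [IsFiniteMeasureOnCompacts ρ] [ρ.IsOpenPosMeasure]
  [ρ.IsInvInvariant] [SFinite ρ]
  (hρ : Measure.map (Subgroup.prodEquiv H₁ H₂) ρ = ρ₁.prod ρ₂)
  (ν₁ : Measure G₁) [IsHaarMeasure ν₁] [ν₁.IsMulRightInvariant]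
  (ν₂ : Measure G₂) [IsHaarMeasure ν₂] [ν₂.IsMulRightInvariant]
  [MeasurableSpace (G₁ ⧸ H₁)] [BorelSpace (G₁ ⧸ H₁)] [MeasurableSpace (G₂ ⧸ H₂)] [BorelSpace (G₂ ⧸ H₂)]
  [MeasurableSpace ((G₁ × G₂) ⧸ H₁.prod H₂)] [BorelSpace ((G₁ × G₂) ⧸ H₁.prod H₂)]

include hρ in
/-- **`(ν₁ ⊗ ν₂)/(ρ₁ ⊗ ρ₂) = (ν₁/ρ₁) ⊠ (ν₂/ρ₂)`** — the quotient measure of the product Haar measures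
by the product subgroup is the transported product of the quotient measures: with
`e : (G₁ × G₂) ⧸ (H₁ × H₂) ≃ₜ (G₁ ⧸ H₁) × (G₂ ⧸ H₂)`,
`quotientMeasure (H₁ × H₂) ρ (ν₁ ⊗ ν₂) = (e⁻¹)_* (quotientMeasure H₁ ρ₁ ν₁ ⊗ quotientMeasure H₂ ρ₂ ν₂)`.
Proof: the right side is invariant and finite on compact sets, so it is `c •` the left side with
`c` its unfolding constant (`eq_unfoldingConstant_smul_quotientMeasure`); evaluating Weil's formula on
`g₁ ⊗ g₂` with `g_i ∈ C_c(G_i)`, `g_i ≥ 0`, `g_i(1) ≠ 0` (fibre integrals factor, Tonelli, Weil with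
constant `1` on each factor) gives `c (∫ g₁)(∫ g₂) = (∫ g₁)(∫ g₂)`, whence `c = 1`.
[cite: Folland1995, §2.6 Thm. 2.49, (2.52)] [cite: Bump1997, §3.3 Prop. 3.3.2] -/
theorem map_quotientProdHomeomorph_symm_prod_quotientMeasure_eq :
    Measure.map (quotientProdHomeomorph H₁ H₂).symm
        ((quotientMeasure H₁ ρ₁ hH₁ ν₁).prod (quotientMeasure H₂ ρ₂ hH₂ ν₂)) =
      quotientMeasure (H₁.prod H₂) ρ (isClosed_coe_prod H₁ H₂ hH₁ hH₂) (ν₁.prod ν₂) := by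
  haveI : IsClosed ((H₁.prod H₂ : Subgroup (G₁ × G₂)) : Set (G₁ × G₂)) := isClosed_coe_prod H₁ H₂ hH₁ hH₂
  set q₁ := quotientMeasure H₁ ρ₁ hH₁ ν₁ with hq₁
  set q₂ := quotientMeasure H₂ ρ₂ hH₂ ν₂ with hq₂
  set q := quotientMeasure (H₁.prod H₂) ρ (isClosed_coe_prod H₁ H₂ hH₁ hH₂) (ν₁.prod ν₂) with hq
  set μ := Measure.map (quotientProdHomeomorph H₁ H₂).symm (q₁.prod q₂) with hμ
  haveI : SMulInvariantMeasure (G₁ × G₂) _ μ := smulInvariantMeasure_map_symm_prod H₁ H₂ q₁ q₂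
  haveI : IsFiniteMeasureOnCompacts μ := isFiniteMeasureOnCompacts_map_symm_prod H₁ H₂ q₁ q₂
  have hμq : μ = unfoldingConstant (H₁.prod H₂) ρ μ (ν₁.prod ν₂) • q :=
    eq_unfoldingConstant_smul_quotientMeasure (H₁.prod H₂) ρ (ν₁.prod ν₂) μ
  -- test functions
  obtain ⟨g₁, hg₁s, hg₁0, hg₁1⟩ := exists_continuous_nonneg_pos (1 : G₁)
  obtain ⟨g₂, hg₂s, hg₂0, hg₂1⟩ := exists_continuous_nonneg_pos (1 : G₂)
  set f₁ : G₁ → ℝ≥0∞ := fun x => ENNReal.ofReal (g₁ x) with hf₁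
  set f₂ : G₂ → ℝ≥0∞ := fun x => ENNReal.ofReal (g₂ x) with hf₂
  have hf₁m : Measurable f₁ := ENNReal.measurable_ofReal.comp g₁.continuous.measurable
  have hf₂m : Measurable f₂ := ENNReal.measurable_ofReal.comp g₂.continuous.measurable
  have hfm : Measurable fun p : G₁ × G₂ => f₁ p.1 * f₂ p.2 := (hf₁m.comp measurable_fst).mul (hf₂m.comp measurable_snd)
  -- the integrals of the test functions are positive and finite
  have hI₁ : ∫⁻ x, f₁ x ∂ν₁ = ENNReal.ofReal (∫ x, g₁ x ∂ν₁) :=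
    (ofReal_integral_eq_lintegral_ofReal (g₁.continuous.integrable_of_hasCompactSupport hg₁s)
      (Eventually.of_forall hg₁0)).symm
  have hI₂ : ∫⁻ x, f₂ x ∂ν₂ = ENNReal.ofReal (∫ x, g₂ x ∂ν₂) :=
    (ofReal_integral_eq_lintegral_ofReal (g₂.continuous.integrable_of_hasCompactSupport hg₂s)
      (Eventually.of_forall hg₂0)).symm
  have hp₁ : 0 < ∫ x, g₁ x ∂ν₁ := g₁.continuous.integral_pos_of_hasCompactSupport_nonneg_nonzero hg₁s hg₁0 hg₁1
  have hp₂ : 0 < ∫ x, g₂ x ∂ν₂ := g₂.continuous.integral_pos_of_hasCompactSupport_nonneg_nonzero hg₂s hg₂0 hg₂1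
  have hIne : (∫⁻ x, f₁ x ∂ν₁) * ∫⁻ x, f₂ x ∂ν₂ ≠ 0 := by
    rw [hI₁, hI₂]
    exact mul_ne_zero (ENNReal.ofReal_pos.2 hp₁).ne' (ENNReal.ofReal_pos.2 hp₂).ne'
  have hItop : (∫⁻ x, f₁ x ∂ν₁) * ∫⁻ x, f₂ x ∂ν₂ ≠ ∞ := by
    rw [hI₁, hI₂]
    exact ENNReal.mul_ne_top ENNReal.ofReal_ne_top ENNReal.ofReal_ne_top
  -- Weil's formula for `μ` on `f₁ ⊗ f₂`, computed two ways
  have hweil := lintegral_fiberLIntegral_eq_mul_lintegral (H₁.prod H₂) ρ μ (ν₁.prod ν₂) hfm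
  have hlhs : ∫⁻ x, fiberLIntegral (H₁.prod H₂) ρ (fun p : G₁ × G₂ => f₁ p.1 * f₂ p.2) x ∂μ =
      (∫⁻ x, f₁ x ∂ν₁) * ∫⁻ x, f₂ x ∂ν₂ := by
    rw [hμ, ← Homeomorph.toMeasurableEquiv_coe, lintegral_map_equiv]
    have hpt : ∀ y : (G₁ ⧸ H₁) × (G₂ ⧸ H₂),
        fiberLIntegral (H₁.prod H₂) ρ (fun p : G₁ × G₂ => f₁ p.1 * f₂ p.2)
            ((quotientProdHomeomorph H₁ H₂).symm.toMeasurableEquiv y) =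
          fiberLIntegral H₁ ρ₁ f₁ y.1 * fiberLIntegral H₂ ρ₂ f₂ y.2 := by
      rintro ⟨y₁, y₂⟩
      induction y₁ using QuotientGroup.induction_on with
      | H a =>
        induction y₂ using QuotientGroup.induction_on with
        | H b =>
          rw [Homeomorph.toMeasurableEquiv_coe, coe_quotientProdHomeomorph_symm, prodEquiv_symm_mk]
          exact fiberLIntegral_prod_mul_eq H₁ H₂ ρ₁ ρ₂ ρ hρ hf₁m hf₂m a b
    simp_rw [hpt]
    rw [lintegral_prod_mul (measurable_fiberLIntegral H₁ ρ₁ hf₁m).aemeasurable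
        (measurable_fiberLIntegral H₂ ρ₂ hf₂m).aemeasurable,
      lintegral_fiberLIntegral_quotientMeasure H₁ ρ₁ ν₁ hf₁m, lintegral_fiberLIntegral_quotientMeasure H₂ ρ₂ ν₂ hf₂m]
  have hrhs : ∫⁻ p, f₁ p.1 * f₂ p.2 ∂(ν₁.prod ν₂) = (∫⁻ x, f₁ x ∂ν₁) * ∫⁻ x, f₂ x ∂ν₂ :=
    lintegral_prod_mul hf₁m.aemeasurable hf₂m.aemeasurable
  rw [hlhs, hrhs] at hweil
  -- so the unfolding constant is `1`
  have hc : unfoldingConstant (H₁.prod H₂) ρ μ (ν₁.prod ν₂) = 1 := by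
    have h1 : (unfoldingConstant (H₁.prod H₂) ρ μ (ν₁.prod ν₂) : ℝ≥0∞) = 1 := by
      have := (ENNReal.mul_left_inj hIne hItop).1 (hweil.symm.trans (one_mul _).symm)
      exact this
    exact_mod_cast h1
  rw [hμq, hc, one_smul]

include hρ in
/-- The same read in product coordinates: `e_* ((ν₁ ⊗ ν₂)/(ρ₁ ⊗ ρ₂)) = (ν₁/ρ₁) ⊗ (ν₂/ρ₂)`.
[cite: Folland1995, §2.6 Thm. 2.49, (2.52)] -/
theorem map_quotientProdHomeomorph_quotientMeasure_prod :
    Measure.map (quotientProdHomeomorph H₁ H₂)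
        (quotientMeasure (H₁.prod H₂) ρ (isClosed_coe_prod H₁ H₂ hH₁ hH₂) (ν₁.prod ν₂)) =
      (quotientMeasure H₁ ρ₁ hH₁ ν₁).prod (quotientMeasure H₂ ρ₂ hH₂ ν₂) := by
  rw [← map_quotientProdHomeomorph_symm_prod_quotientMeasure_eq H₁ H₂ ρ₁ ρ₂ ρ hρ ν₁ ν₂,
    Measure.map_map (quotientProdHomeomorph H₁ H₂).measurable (quotientProdHomeomorph H₁ H₂).symm.measurable,
    Homeomorph.self_comp_symm, Measure.map_id]

include hρ in
/-- **Tonelli without constant**: `∫⁻ F d((ν₁⊗ν₂)/(ρ₁⊗ρ₂)) = ∫⁻_{G₁/H₁} ∫⁻_{G₂/H₂} F((x₁, x₂)(H₁ × H₂)) d(ν₂/ρ₂) d(ν₁/ρ₁)`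
for measurable `F ≥ 0`. [cite: Folland1995, §2.6 Thm. 2.49, (2.52)] -/
theorem lintegral_quotientMeasure_prod_eq_lintegral_lintegral
    {F : (G₁ × G₂) ⧸ H₁.prod H₂ → ℝ≥0∞} (hF : Measurable F) :
    ∫⁻ x, F x ∂quotientMeasure (H₁.prod H₂) ρ (isClosed_coe_prod H₁ H₂ hH₁ hH₂) (ν₁.prod ν₂) =
      ∫⁻ x₁, ∫⁻ x₂, F ((QuotientGroup.prodEquiv H₁ H₂).symm (x₁, x₂))
        ∂quotientMeasure H₂ ρ₂ hH₂ ν₂ ∂quotientMeasure H₁ ρ₁ hH₁ ν₁ := by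
  have h := lintegral_eq_mul_lintegral_lintegral H₁ H₂ (quotientMeasure H₁ ρ₁ hH₁ ν₁) (quotientMeasure H₂ ρ₂ hH₂ ν₂)
    (μ := quotientMeasure (H₁.prod H₂) ρ (isClosed_coe_prod H₁ H₂ hH₁ hH₂) (ν₁.prod ν₂)) (c := 1)
    (by rw [one_smul, map_quotientProdHomeomorph_symm_prod_quotientMeasure_eq H₁ H₂ ρ₁ ρ₂ ρ hρ ν₁ ν₂]) hF
  rw [h, ENNReal.coe_one, one_mul]

include hρ in
/-- **Fubini without constant (Bochner)**: `∫ F d((ν₁⊗ν₂)/(ρ₁⊗ρ₂)) = ∫_{G₁/H₁ × G₂/H₂} F((x₁, x₂)(H₁ × H₂)) d((ν₁/ρ₁) ⊗ (ν₂/ρ₂))`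
for every Banach-valued `F`. [cite: Folland1995, §2.6 Thm. 2.49, (2.52)] -/
theorem integral_quotientMeasure_prod_eq_integral_prod {E : Type*} [NormedAddCommGroup E] [NormedSpace ℝ E]
    (F : (G₁ × G₂) ⧸ H₁.prod H₂ → E) :
    ∫ x, F x ∂quotientMeasure (H₁.prod H₂) ρ (isClosed_coe_prod H₁ H₂ hH₁ hH₂) (ν₁.prod ν₂) =
      ∫ p, F ((QuotientGroup.prodEquiv H₁ H₂).symm p)
        ∂(quotientMeasure H₁ ρ₁ hH₁ ν₁).prod (quotientMeasure H₂ ρ₂ hH₂ ν₂) := by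
  have h := integral_eq_smul_integral_prod H₁ H₂ (quotientMeasure H₁ ρ₁ hH₁ ν₁) (quotientMeasure H₂ ρ₂ hH₂ ν₂)
    (μ := quotientMeasure (H₁.prod H₂) ρ (isClosed_coe_prod H₁ H₂ hH₁ hH₂) (ν₁.prod ν₂)) (c := 1)
    (by rw [one_smul, map_quotientProdHomeomorph_symm_prod_quotientMeasure_eq H₁ H₂ ρ₁ ρ₂ ρ hρ ν₁ ν₂]) F
  rw [h, one_smul]

include hρ in
/-- **Product integrands factor exactly**: if `F((x₁, x₂)(H₁ × H₂)) = f₁(x₁) f₂(x₂)` then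
`∫ F d((ν₁⊗ν₂)/(ρ₁⊗ρ₂)) = (∫ f₁ d(ν₁/ρ₁)) (∫ f₂ d(ν₂/ρ₂))` — the normalised form of the factorisation of
orbital integrals of product functions (Gelbart's (10.19) with an equality sign for product Haar
measures). [cite: Gelbart1975, p. 155 (10.19)] [cite: Folland1995, §2.6 (2.52)] -/
theorem integral_quotientMeasure_prod_mul_eq_mul (F : (G₁ × G₂) ⧸ H₁.prod H₂ → ℂ) (f₁ : G₁ ⧸ H₁ → ℂ)
    (f₂ : G₂ ⧸ H₂ → ℂ) (hF : ∀ x₁ x₂, F ((QuotientGroup.prodEquiv H₁ H₂).symm (x₁, x₂)) = f₁ x₁ * f₂ x₂) :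
    ∫ x, F x ∂quotientMeasure (H₁.prod H₂) ρ (isClosed_coe_prod H₁ H₂ hH₁ hH₂) (ν₁.prod ν₂) =
      (∫ x, f₁ x ∂quotientMeasure H₁ ρ₁ hH₁ ν₁) * ∫ x, f₂ x ∂quotientMeasure H₂ ρ₂ hH₂ ν₂ := by
  have h := integral_mul_eq_smul_integral_mul_integral H₁ H₂ (quotientMeasure H₁ ρ₁ hH₁ ν₁) (quotientMeasure H₂ ρ₂ hH₂ ν₂)
    (μ := quotientMeasure (H₁.prod H₂) ρ (isClosed_coe_prod H₁ H₂ hH₁ hH₂) (ν₁.prod ν₂)) (c := 1)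
    (by rw [one_smul, map_quotientProdHomeomorph_symm_prod_quotientMeasure_eq H₁ H₂ ρ₁ ρ₂ ρ hρ ν₁ ν₂]) F f₁ f₂ hF
  rw [h, one_smul]

end ProdNormalized

end Literature.MeasureTheory.Group
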